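import Literature.NumberTheory.PAdicHodge.FormalGroupDivisionSaturation
import Literature.NumberTheory.PAdicHodge.AinfWeierstrassTorsionLiftAdd
import HarnessLib

/-!
# Saturation of approximate `[p]_W`-division sequences on `Ŵ(𝔪_{ℂ_F})`: the φ-road's `mulPC`, and the compatibility of
# saturation with the Galois action and with the formal-group law

Topic `Literature/NumberTheory/PAdicHodge`; namespace `Literature.NumberTheory.PAdicHodge.AinfTop` (theorems only; no definition,
no named fact, no instance, no `sorry`). Sequel of `FormalGroupDivisionSaturation` (generic complete ultrametric field `K`), read on
`K = ℂ_F` for a `p`-adic field `F` (`‖p‖ < 1` from `Fact (¬ IsUnit (p : 𝒪_{ℂ_F}))`), where the point set is the tree's `maxNilIdealC F`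
and `[p]_W` on it is LITERALLY `AinfTop.mulPC F p W` (`W/ℤ` an integral Weierstrass equation):

* ★★ `exists_mulPC_divisionSeq_norm_sub_le` — an approximate division sequence `v` (`‖[p]v_{n+1} − v_n‖ ≤ δ < 1`) is `δ`-close to an
  EXACT one `w` (`mulPC (w (n+1)) = w n`: exactly the hypothesis `hup` of the φ-road's towers `divisionLiftPt`,
  `BmaxPlusFormalLogDivisionTower`); ★★ `mulPC_divisionSeq_unique` — RIGIDITY: exact sequences termwise `δ`-close are equal;
* `norm_galSeq_sub_galSeq_eq` (`Γ_F` is isometric), ★ `galSeq_eq_of_divisionSeq_norm_sub_le` — saturation COMMUTES WITH `Γ_F`;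
* `norm_addWC_sub_addWC_le` (`⊕_W` is `1`-Lipschitz in each variable), ★ `addSeq_eq_of_divisionSeq_norm_sub_le` — saturation is ADDITIVE;
* `eq_of_divisionSeq_norm_sub_le_of_exact` — saturation fixes exact sequences.

Purpose (line `kato_lever`, crux K★ `stmt-BirchSwinnertonDyer-22226`, memo `Lines/kato-lever-K2-ramified-cm-transport.md`): the
«CM-fibre transport» `T : v ↦ w` from `[p]_{W_L}`-division sequences of the RAMIFIED good model `W_L ≡ E₀ (mod ϖ)` of a K★ cell to exact
`[p]_{E₀}`-division sequences of the `ℤ`-curve `E₀`; by the two ★ compatibilities `T` is additive and `Γ_F`-equivariant, so the Kummer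
tower of a rational point and the Tate module of `W_L` are transported into the unramified φ-road. BSD / K★ are not proved by any of this.

## References
* P. Colmez, *Périodes p-adiques des variétés abéliennes*, Math. Ann. 292 (1992), §2. [Colmez1992PeriodesAbeliennes]
* J.-M. Fontaine, *Le corps des périodes p-adiques*, Astérisque 223 (1994), Exp. II §1.2. [FontaineAsterisque223III]
* J. H. Silverman, *The Arithmetic of Elliptic Curves* (2009), IV.2.3, IV.4.4. [SilvermanAEC2009]
* J.-P. Serre, *Local class field theory* (Cassels–Fröhlich Ch. VI) §3.2. [CasselsFrohlichANT1967]
-/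

noncomputable section

open PowerSeries Filter Topology
open scoped Classical

namespace Literature.NumberTheory.PAdicHodge

open Literature.NumberTheory.GaloisRepresentations.LubinTate Literature.NumberTheory.EllipticCurves

/-! ## §4 On `Ŵ(𝔪_{ℂ_F})`: the φ-road's `mulPC`, Galois and addition compatibilities -/

namespace AinfTop

open Literature.NumberTheory.GaloisRepresentations Literature.NumberTheory.GaloisRepresentations.IsNonarchimedeanLocalField
open Field WittVector

variable {F : Type} [Field F] [ValuativeRel F] [TopologicalSpace F] [IsNonarchimedeanLocalField F]
  {p : ℕ} [hp : Fact p.Prime] [Fact (¬ IsUnit (p : integerC F))] (W : WeierstrassCurve ℤ)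

/-- ★★ **SATURATION on `Ŵ(𝔪_{ℂ_F})`**: an approximate `[p]_W`-division sequence `v` (`‖[p]v_{n+1} − v_n‖ ≤ δ < 1`, `[p] = AinfTop.mulPC F p W`)
is `δ`-close to an EXACT one (`mulPC (w (n+1)) = w n`, the hypothesis `hup` of the φ-road's `divisionLiftPt` towers).
[cite: Colmez1992PeriodesAbeliennes, §2] [cite: SilvermanAEC2009, IV.4.4] -/
theorem exists_mulPC_divisionSeq_norm_sub_le {δ : ℝ} (hδ : δ < 1) (v : ℕ → (maxNilIdealC F).toIdeal)
    (hv : ∀ m, ‖(((mulPC F p W (v (m + 1)) : (maxNilIdealC F).toIdeal) : CBall F) : CompletedAlgClosure F) -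
      (((v m : (maxNilIdealC F).toIdeal) : CBall F) : CompletedAlgClosure F)‖ ≤ δ) :
    ∃ w : ℕ → (maxNilIdealC F).toIdeal, (∀ n, mulPC F p W (w (n + 1)) = w n) ∧
      ∀ n, ‖(((w n : (maxNilIdealC F).toIdeal) : CBall F) : CompletedAlgClosure F) -
        (((v n : (maxNilIdealC F).toIdeal) : CBall F) : CompletedAlgClosure F)‖ ≤ δ :=
  exists_divisionSeq_norm_sub_le (K := CompletedAlgClosure F) W norm_natCast_C_lt_one' hδ v hv

/-- ★★ **RIGIDITY of `[p]_W`-towers on `Ŵ(𝔪_{ℂ_F})`**: two exact `mulPC`-division sequences which are termwise `δ`-close (`δ < 1`) are equal.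
[cite: Colmez1992PeriodesAbeliennes, §2] [cite: SilvermanAEC2009, IV.4.4] -/
theorem mulPC_divisionSeq_unique {δ : ℝ} (hδ : δ < 1) (w w' : ℕ → (maxNilIdealC F).toIdeal)
    (hw : ∀ n, mulPC F p W (w (n + 1)) = w n) (hw' : ∀ n, mulPC F p W (w' (n + 1)) = w' n)
    (h : ∀ n, ‖(((w n : (maxNilIdealC F).toIdeal) : CBall F) : CompletedAlgClosure F) -
      (((w' n : (maxNilIdealC F).toIdeal) : CBall F) : CompletedAlgClosure F)‖ ≤ δ) : w = w' :=
  divisionSeq_unique_of_norm_sub_le (K := CompletedAlgClosure F) W norm_natCast_C_lt_one' hδ w w' hw hw' h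

omit hp [Fact (¬ IsUnit (p : integerC F))] in
/-- `Γ_F` acts isometrically on `𝔪_{ℂ_F}`: `‖σs − σt‖ = ‖s − t‖` (`galSeq`). [cite: FontaineAsterisque223III, Exp. II §1.2] -/
theorem norm_galSeq_sub_galSeq_eq (σ : absoluteGaloisGroup F) (s t : ℕ → (maxNilIdealC F).toIdeal) (n : ℕ) :
    ‖(((galSeq F σ s n : (maxNilIdealC F).toIdeal) : CBall F) : CompletedAlgClosure F) -
        (((galSeq F σ t n : (maxNilIdealC F).toIdeal) : CBall F) : CompletedAlgClosure F)‖ =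
      ‖(((s n : (maxNilIdealC F).toIdeal) : CBall F) : CompletedAlgClosure F) -
        (((t n : (maxNilIdealC F).toIdeal) : CBall F) : CompletedAlgClosure F)‖ := by
  rw [coe_galSeq, coe_galSeq, ← AddSubgroupClass.coe_sub, ← map_sub, coe_galCBall, CompletedAlgClosure.norm_smul,
    AddSubgroupClass.coe_sub]

/-- **Saturation commutes with `Γ_F`**: if `w` is the exact division sequence `δ`-close to `v`, then `σw` is the exact division sequence
`δ`-close to `σv` — every exact sequence `δ`-close to `σv` equals `σw`. [cite: FontaineAsterisque223III, Exp. II §1.2] -/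
theorem galSeq_eq_of_divisionSeq_norm_sub_le [CharZero F] [IsAdicComplete (Ideal.span {(p : integerC F)}) (integerC F)]
    (hθ : Function.Surjective (fontaineTheta (integerC F) p)) (σ : absoluteGaloisGroup F)
    {δ : ℝ} (hδ : δ < 1) {v w : ℕ → (maxNilIdealC F).toIdeal} (hw : ∀ n, mulPC F p W (w (n + 1)) = w n)
    (hwv : ∀ n, ‖(((w n : (maxNilIdealC F).toIdeal) : CBall F) : CompletedAlgClosure F) -
      (((v n : (maxNilIdealC F).toIdeal) : CBall F) : CompletedAlgClosure F)‖ ≤ δ)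
    (w' : ℕ → (maxNilIdealC F).toIdeal) (hw' : ∀ n, mulPC F p W (w' (n + 1)) = w' n)
    (hw'v : ∀ n, ‖(((w' n : (maxNilIdealC F).toIdeal) : CBall F) : CompletedAlgClosure F) -
      (((galSeq F σ v n : (maxNilIdealC F).toIdeal) : CBall F) : CompletedAlgClosure F)‖ ≤ δ) :
    w' = galSeq F σ w := by
  have hδ0 : 0 ≤ δ := (norm_nonneg _).trans (hwv 0)
  -- `σw` is exact and `δ`-close to `σv`; both `w'` and `σw` are then `δ`-close to `σv`, hence `δ`-close to each other
  refine mulPC_divisionSeq_unique W hδ w' (galSeq F σ w) hw' (mulPC_galSeq W hθ σ hw) fun n => ?_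
  have hsplit : ∀ a b c : CompletedAlgClosure F, a - c = (a - b) + (b - c) := fun a b c => by ring
  rw [hsplit _ (((galSeq F σ v n : (maxNilIdealC F).toIdeal) : CBall F) : CompletedAlgClosure F)]
  refine (IsUltrametricDist.norm_add_le_max _ _).trans (max_le (hw'v n) ?_)
  rw [← norm_neg, neg_sub, norm_galSeq_sub_galSeq_eq]
  exact hwv n

omit hp [Fact (¬ IsUnit (p : integerC F))] in
/-- **`⊕_W` is `1`-Lipschitz in each variable on `Ŵ(𝔪_{ℂ_F})`**: `‖(s ⊕ s') − (t ⊕ t')‖ ≤ max(‖s − t‖, ‖s' − t'‖)`.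
[cite: CasselsFrohlichANT1967, Ch. VI §3.2] -/
theorem norm_addWC_sub_addWC_le (s s' t t' : (maxNilIdealC F).toIdeal) :
    ‖(((addWC F W s s' : (maxNilIdealC F).toIdeal) : CBall F) : CompletedAlgClosure F) -
        (((addWC F W t t' : (maxNilIdealC F).toIdeal) : CBall F) : CompletedAlgClosure F)‖ ≤
      max ‖(((s : (maxNilIdealC F).toIdeal) : CBall F) : CompletedAlgClosure F) - (((t : (maxNilIdealC F).toIdeal) : CBall F) : CompletedAlgClosure F)‖
        ‖(((s' : (maxNilIdealC F).toIdeal) : CBall F) : CompletedAlgClosure F) - (((t' : (maxNilIdealC F).toIdeal) : CBall F) : CompletedAlgClosure F)‖ :=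
  norm_evalPt_two_sub_le (K := CompletedAlgClosure F) W.formalGroupLaw W.constantCoeff_formalGroupLaw ![s, s'] ![t, t']

/-- **Saturation is additive**: if `w, w'` are the exact division sequences `δ`-close to `v, v'`, then `w ⊕ w'` (`addSeq`) is the exact division
sequence `δ`-close to `v ⊕ v'` — every exact sequence `δ`-close to `v ⊕ v'` equals `w ⊕ w'`. [cite: SilvermanAEC2009, IV.2.3] -/
theorem addSeq_eq_of_divisionSeq_norm_sub_le {δ : ℝ} (hδ : δ < 1) {v v' w w' : ℕ → (maxNilIdealC F).toIdeal}
    (hw : ∀ n, mulPC F p W (w (n + 1)) = w n) (hw' : ∀ n, mulPC F p W (w' (n + 1)) = w' n)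
    (hwv : ∀ n, ‖(((w n : (maxNilIdealC F).toIdeal) : CBall F) : CompletedAlgClosure F) -
      (((v n : (maxNilIdealC F).toIdeal) : CBall F) : CompletedAlgClosure F)‖ ≤ δ)
    (hw'v' : ∀ n, ‖(((w' n : (maxNilIdealC F).toIdeal) : CBall F) : CompletedAlgClosure F) -
      (((v' n : (maxNilIdealC F).toIdeal) : CBall F) : CompletedAlgClosure F)‖ ≤ δ)
    (u : ℕ → (maxNilIdealC F).toIdeal) (hu : ∀ n, mulPC F p W (u (n + 1)) = u n)
    (huv : ∀ n, ‖(((u n : (maxNilIdealC F).toIdeal) : CBall F) : CompletedAlgClosure F) -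
      (((addSeq F W v v' n : (maxNilIdealC F).toIdeal) : CBall F) : CompletedAlgClosure F)‖ ≤ δ) :
    u = addSeq F W w w' := by
  refine mulPC_divisionSeq_unique W hδ u (addSeq F W w w') hu (mulPC_addSeq W hw hw') fun n => ?_
  have hsplit : ∀ a b c : CompletedAlgClosure F, a - c = (a - b) + (b - c) := fun a b c => by ring
  rw [hsplit _ (((addSeq F W v v' n : (maxNilIdealC F).toIdeal) : CBall F) : CompletedAlgClosure F)]
  refine (IsUltrametricDist.norm_add_le_max _ _).trans (max_le (huv n) ?_)
  rw [← norm_neg, neg_sub]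
  exact (norm_addWC_sub_addWC_le W _ _ _ _).trans (max_le (hwv n) (hw'v' n))

/-- **Saturation fixes exact sequences** (and hence is idempotent): an exact division sequence `δ`-close to an EXACT `v` is `v` itself.
[cite: Colmez1992PeriodesAbeliennes, §2] -/
theorem eq_of_divisionSeq_norm_sub_le_of_exact {δ : ℝ} (hδ : δ < 1) {v w : ℕ → (maxNilIdealC F).toIdeal}
    (hv : ∀ n, mulPC F p W (v (n + 1)) = v n) (hw : ∀ n, mulPC F p W (w (n + 1)) = w n)
    (hwv : ∀ n, ‖(((w n : (maxNilIdealC F).toIdeal) : CBall F) : CompletedAlgClosure F) -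
      (((v n : (maxNilIdealC F).toIdeal) : CBall F) : CompletedAlgClosure F)‖ ≤ δ) : w = v :=
  mulPC_divisionSeq_unique W hδ w v hw hv hwv

end AinfTop

end Literature.NumberTheory.PAdicHodge
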